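import Mathlib
import Summits.Schanuel.Schanuel.Theses.BakerOverExpField

/-!
# Line `birth` — BC3 skeleton for the crux `BakerOverL` (stmt-Schanuel-19261)

Route `BakerOverExpField` (route-Schanuel-BakerOverExpField), crux (rank 2)
`Summit.Schanuel.Schanuel.Theses.BakerOverExpField.BakerOverL`: for every `n` and every
`ℚ`-linearly independent `z : Fin n → ℂ`,

  `n + 1 ≤ dim_L span_L(1, z₁, …, zₙ) + trdeg_ℚ K`,   `K = ℚ(e^{z₁}, …, e^{zₙ})`,
  `L` = the algebraic closure of `K` inside `ℂ` (`algebraicClosure K ℂ`).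

THE LINE (homogeneous / inhomogeneous split — the shape of Baker's theorem itself; registrar
skeleton, no engine claimed).  Write `d₀ = dim_L span_L(z₁, …, zₙ)` (NO constant adjoined),
`d = dim_L span_L(1, z₁, …, zₙ)`, `b = trdeg_ℚ K`.  Always `d₀ ≤ d ≤ d₀ + 1`, and `d = d₀ + 1`
iff `1 ∉ span_L(z)`.  Hence the crux `n + 1 ≤ d + b` splits into exactly two statements:

* `stub_homogeneousLossyBaker` (H, the load-bearing stub) — `n ≤ d₀ + b`: enlarging the
  coefficient field from `ℚ̄` to `L` costs the `ℚ`-span of `z₁, …, zₙ` at most `b` dimensions.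
  Layer `b = 0` (all `e^{zᵢ}` algebraic, `L = ℚ̄`): HOMOGENEOUS Baker — `ℚ`-linearly independent
  logarithms of algebraic numbers are `ℚ̄`-linearly independent (in tree:
  `Literature.NumberTheory.Transcendental.baker_expField_logLayer`, Baker 1975 Thm 2.1).
  Layer `b = 1` already contains, at `z = (1, e)`, "`e^e` transcendental ⇒ nothing more to pay",
  and at Gelfond towers `z = log α · (1, β, …, β^{k-1})` Gelfond's conjecture graded by `b`.
* `stub_inhomogeneousStep` (I) — in the EXTREMAL case `n = d₀ + b` of H, `1 ∉ span_L(z₁, …, zₙ)`.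
  Layer `b = 0`: given homogeneous Baker (`d₀ = n`), this is exactly the INHOMOGENEOUS half of
  Baker's theorem (`1, log α₁, …, log αₙ` are `ℚ̄`-linearly independent); `n = 1`: Hermite–Lindemann
  (`log α ∉ ℚ̄`).  Layer `b = 1` at `z = (1, iπ)` (`K = ℚ(e)`, `d₀ = 1` iff `π ∈ ℚ(e)^{alg}`):
  vacuous or — combined with H — the statement "`e` and `π` are algebraically independent".
* `BakerOverL_of : H-sig → I-sig → BakerOverL` — REAL proof (linear algebra + cardinal
  arithmetic, sorry-free): if `n < d₀ + b` then `n + 1 ≤ d₀ + b ≤ d + b`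
  (`Cardinal.add_one_le_of_lt`, `Submodule.finrank_mono`); if `n = d₀ + b` then I gives
  `1 ∉ span_L(z)`, so `span_L(z) < span_L(1, z)` and `d₀ + 1 ≤ d`
  (`Submodule.finrank_lt_finrank_of_lt`), whence `n + 1 = d₀ + 1 + b ≤ d + b`.
  `bakerOverL_of_stubs : BakerOverL` applies it to the two stubs BY NAME.

Content of the split (paper argument, `Lines/birth.md`): under Schanuel both stubs hold
(S ⇒ H by the tower law `trdeg ℚ(z, e^z) = b + trdeg_L L(z) ≤ b + d₀`; S ⇒ I because in the
extremal case an `L`-basis of `span_L(z)` chosen among the `zᵢ` is algebraically independent over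
`L`, so no `L`-linear combination of it equals `1`).  Conversely BakerOverL ⇒ H (`d ≤ d₀ + 1`) and
BakerOverL ⇒ I (`b ≤ n` is finite, so `d₀ + b + 1 ≤ d + b` forces `d₀ < d`): the split is an
honest equivalence `BakerOverL ⟺ H ∧ I`, neither half gives the crux alone (H misses every
inhomogeneous statement, e.g. `log 2 ∉ ℚ̄`-type content at `b = 0`; I is conditional on the
extremal case and says nothing when `n < d₀ + b`), and neither mentions the summit.
`sorry` occurs ONLY in the two `stub_*`.

References: A. Baker, *Transcendental Number Theory* (1975), Thm 2.1 (homogeneous and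
inhomogeneous forms); G. V. Chudnovsky, *Contributions to the theory of transcendental numbers*
(1984), Ch. 2, Thm 1.1 p. 138 and Thm 3.1 p. 153 (Baker's method over a coefficient field of
transcendence type ≤ τ); M. Waldschmidt, *Diophantine approximation on linear algebraic groups*
(2000), Conj. 1.14 and §1.4; Yu. Nesterenko – P. Philippon (eds.), *Introduction to algebraic
independence theory*, LNM 1752 (2001), Ch. 14 (Gelfond towers, Cor. 2.8 p. 249).
-/

-- `Summit.Schanuel.Schanuel.…`: the duplicated component is the mandated layout of this single-conjunct summit.
set_option linter.dupNamespace false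

noncomputable section

namespace Summit.Schanuel.Schanuel.Cruxes.BakerOverL.Birth

open Summit.Schanuel.Schanuel.Theses.BakerOverExpField

/-! ## The two registered OPEN stubs -/

/-- **Stub H (homogeneous lossy Baker over `L`; load-bearing).**  For every `n` and every
`ℚ`-linearly independent `z : Fin n → ℂ`,
`n ≤ dim_L span_L(z₁, …, zₙ) + trdeg_ℚ ℚ(e^{z₁}, …, e^{zₙ})`, where `L` is the algebraic closure in
`ℂ` of `ℚ(e^{z₁}, …, e^{zₙ})`: passing from coefficients in `ℚ̄` to coefficients in `L` costs the
`ℚ`-span of the `zᵢ` at most `b = trdeg` dimensions.  Layer `b = 0` is homogeneous Baker (proved,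
`baker_expField_logLayer`); layers `b ≥ 1` are open (they contain Gelfond's conjecture on towers,
graded by `b`).  A consequence of Schanuel (tower law).  Why it might fail: only with Schanuel; the
danger for any proof is that Baker/Gelfond–Schneider auxiliary functions need heights or a
transcendence TYPE on the coefficient field (Chudnovsky 1984, Thm 3.1: `K` of type ≤ τ and an
`M × N` grid of exponentials), and `L` here carries neither.
[cite: Baker1975, Thm 2.1; Chudnovsky1984, Ch. 2 Thm 3.1; Waldschmidt2000, Conj. 1.14] -/
theorem stub_homogeneousLossyBaker :
    ∀ (n : ℕ) (z : Fin n → ℂ), LinearIndependent ℚ z →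
      (n : Cardinal) ≤
        (Module.finrank (algebraicClosure (IntermediateField.adjoin ℚ (Set.range (Complex.exp ∘ z))) ℂ)
            (Submodule.span (algebraicClosure (IntermediateField.adjoin ℚ (Set.range (Complex.exp ∘ z))) ℂ)
              (Set.range z)) : Cardinal) +
          Algebra.trdeg ℚ (IntermediateField.adjoin ℚ (Set.range (Complex.exp ∘ z))) := by
  sorry

/-- **Stub I (inhomogeneous step in the extremal case).**  For every `n` and every `ℚ`-linearly
independent `z : Fin n → ℂ`: IF the homogeneous count is extremal,
`n = dim_L span_L(z₁, …, zₙ) + trdeg_ℚ ℚ(e^z)`, THEN `1 ∉ span_L(z₁, …, zₙ)` — the constant `1` is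
not an `L`-linear combination of the `zᵢ`.  Layer `b = 0` (given homogeneous Baker, `d₀ = n`): the
inhomogeneous half of Baker's theorem (`1, log α₁, …, log αₙ` are `ℚ̄`-linearly independent;
`n = 1` is Hermite–Lindemann `log α ∉ ℚ̄`).  Layer `b = 1`, `z = (1, iπ)`: with H it reads "`e`, `π`
algebraically independent".  A consequence of Schanuel (in the extremal case an `L`-basis of
`span_L(z)` among the `zᵢ` is algebraically independent over `L`).  Why it might fail: only with
Schanuel; as a target the difficulty is that the extremality hypothesis is an EQUALITY of
transcendence degrees that no known method can consume except at `b = 0`, where it is Baker's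
inhomogeneous theorem. [cite: Baker1975, Thm 2.1; Waldschmidt2000, §1.4] -/
theorem stub_inhomogeneousStep :
    ∀ (n : ℕ) (z : Fin n → ℂ), LinearIndependent ℚ z →
      (n : Cardinal) =
        (Module.finrank (algebraicClosure (IntermediateField.adjoin ℚ (Set.range (Complex.exp ∘ z))) ℂ)
            (Submodule.span (algebraicClosure (IntermediateField.adjoin ℚ (Set.range (Complex.exp ∘ z))) ℂ)
              (Set.range z)) : Cardinal) +
          Algebra.trdeg ℚ (IntermediateField.adjoin ℚ (Set.range (Complex.exp ∘ z))) →
      (1 : ℂ) ∉ Submodule.span (algebraicClosure (IntermediateField.adjoin ℚ (Set.range (Complex.exp ∘ z))) ℂ)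
              (Set.range z) := by
  sorry

/-! ## Sorry-free glue: two linear-algebra facts about adjoining one vector, one cardinal step -/

/-- Adjoining a vector to a finite spanning set does not decrease the (finite) dimension of the
span. [folklore] -/
theorem finrank_span_le_finrank_span_insert {L V : Type*} [DivisionRing L] [AddCommGroup V]
    [Module L V] {s : Set V} (hs : s.Finite) (x : V) :
    Module.finrank L (Submodule.span L s) ≤ Module.finrank L (Submodule.span L (insert x s)) := by
  haveI : Module.Finite L (Submodule.span L (insert x s)) :=
    Module.Finite.span_of_finite L (hs.insert x)
  exact Submodule.finrank_mono (Submodule.span_mono (Set.subset_insert _ _))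

/-- Adjoining a vector OUTSIDE the span of a finite set raises the dimension of the span by at
least one. [folklore] -/
theorem finrank_span_succ_le_of_not_mem {L V : Type*} [DivisionRing L] [AddCommGroup V]
    [Module L V] {s : Set V} (hs : s.Finite) {x : V} (hx : x ∉ Submodule.span L s) :
    Module.finrank L (Submodule.span L s) + 1 ≤
      Module.finrank L (Submodule.span L (insert x s)) := by
  haveI : Module.Finite L (Submodule.span L (insert x s)) :=
    Module.Finite.span_of_finite L (hs.insert x)
  have hlt : Submodule.span L s < Submodule.span L (insert x s) := by
    refine lt_of_le_of_ne (Submodule.span_mono (Set.subset_insert _ _)) ?_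
    intro h
    apply hx
    rw [h]
    exact Submodule.subset_span (Set.mem_insert _ _)
  exact Submodule.finrank_lt_finrank_of_lt hlt

/-- The cardinal step: from `n ≤ d₀ + b`, `d₀ ≤ d`, and `n = d₀ + b → d₀ + 1 ≤ d`, conclude
`n + 1 ≤ d + b` (`b` an arbitrary cardinal, `n, d₀, d` natural numbers). [folklore] -/
theorem natCast_succ_le_of_split {n d₀ d : ℕ} {b : Cardinal}
    (hH : (n : Cardinal) ≤ (d₀ : Cardinal) + b) (hd : d₀ ≤ d)
    (hI : (n : Cardinal) = (d₀ : Cardinal) + b → d₀ + 1 ≤ d) :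
    ((n + 1 : ℕ) : Cardinal) ≤ (d : Cardinal) + b := by
  rcases hH.lt_or_eq with hlt | heq
  · calc ((n + 1 : ℕ) : Cardinal) = (n : Cardinal) + 1 := by push_cast; rfl
      _ ≤ (d₀ : Cardinal) + b := Cardinal.add_one_le_of_lt hlt
      _ ≤ (d : Cardinal) + b := add_le_add (Nat.cast_le.mpr hd) le_rfl
  · have h1 : d₀ + 1 ≤ d := hI heq
    calc ((n + 1 : ℕ) : Cardinal) = (n : Cardinal) + 1 := by push_cast; rfl
      _ = ((d₀ + 1 : ℕ) : Cardinal) + b := by rw [heq]; push_cast; ring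
      _ ≤ (d : Cardinal) + b := add_le_add (Nat.cast_le.mpr h1) le_rfl

/-! ## The composition: the two stubs prove the crux BY NAME -/

/-- **THE SKELETON THEOREM (sorry-free).**  Homogeneous lossy Baker over `L` + the inhomogeneous
step in the extremal case ⇒ the crux
`Summit.Schanuel.Schanuel.Theses.BakerOverExpField.BakerOverL`: with `d₀ = dim_L span_L(z)`,
`d = dim_L span_L(1, z)`, `b = trdeg`, either `n < d₀ + b` and `n + 1 ≤ d₀ + b ≤ d + b`, or
`n = d₀ + b`, `1 ∉ span_L(z)`, `d₀ + 1 ≤ d` and `n + 1 ≤ d + b`. [folklore] -/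
theorem BakerOverL_of :
    (∀ (n : ℕ) (z : Fin n → ℂ), LinearIndependent ℚ z →
      (n : Cardinal) ≤
        (Module.finrank (algebraicClosure (IntermediateField.adjoin ℚ (Set.range (Complex.exp ∘ z))) ℂ)
            (Submodule.span (algebraicClosure (IntermediateField.adjoin ℚ (Set.range (Complex.exp ∘ z))) ℂ)
              (Set.range z)) : Cardinal) +
          Algebra.trdeg ℚ (IntermediateField.adjoin ℚ (Set.range (Complex.exp ∘ z)))) →
    (∀ (n : ℕ) (z : Fin n → ℂ), LinearIndependent ℚ z →
      (n : Cardinal) =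
        (Module.finrank (algebraicClosure (IntermediateField.adjoin ℚ (Set.range (Complex.exp ∘ z))) ℂ)
            (Submodule.span (algebraicClosure (IntermediateField.adjoin ℚ (Set.range (Complex.exp ∘ z))) ℂ)
              (Set.range z)) : Cardinal) +
          Algebra.trdeg ℚ (IntermediateField.adjoin ℚ (Set.range (Complex.exp ∘ z))) →
      (1 : ℂ) ∉ Submodule.span (algebraicClosure (IntermediateField.adjoin ℚ (Set.range (Complex.exp ∘ z))) ℂ)
              (Set.range z)) →
    BakerOverL := by
  intro hH hI
  unfold BakerOverL
  intro n z hz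
  exact natCast_succ_le_of_split (hH n z hz)
    (finrank_span_le_finrank_span_insert (Set.finite_range z) (1 : ℂ))
    (fun heq => finrank_span_succ_le_of_not_mem (Set.finite_range z) (hI n z hz heq))

/-- The crux, concluded BY NAME from the two declared stubs (closed only up to their `sorry`s).
[folklore] -/
theorem bakerOverL_of_stubs : BakerOverL :=
  BakerOverL_of stub_homogeneousLossyBaker stub_inhomogeneousStep

end Summit.Schanuel.Schanuel.Cruxes.BakerOverL.Birth

end
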